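import Literature.NumberTheory.EllipticCurves.QuadraticTwistRank
import Literature.NumberTheory.EllipticCurves.GaloisAction
import Literature.NumberTheory.EllipticCurves.RingClassGenusCharacter
import HarnessLib

/-!
# LINE 49 «full_vertex» — twist points are CHARACTER EIGENVECTORS under the Galois action (the `hg` input of the (LOW) dictionary)

Crux R″ `RankOneTwoTorsionResidualAtTwo` (stmt-BirchSwinnertonDyer-27478) of route GenusKolyvaginAtTwo, LINE 49
«torsion_cell_full_vertex_bsdidea1» (pen bsd-idea-1); companion of `…GenusDepthPoints` (the (LOW) dictionary on `E(L)`).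
The dictionary's remaining inputs are the eigen-generators `g χ ∈ E(L)` with `σ • g χ = χ(σ) • g χ`; in memo #6 they are
the odd-twist generators `g′_d ∈ E₀^{(d)}(ℚ)` moved into `E₀(K_gen)`.  This file proves the mechanism for ONE square class:
for a field extension `L/F` (`2 ≠ 0`), `θ ∈ L ∖ F` with `θ² = c ∈ F`, and the tree's TWISTING MAP
`τ = QuadraticDescent.twistMap W hθ hc : W^{(c)}(F) →+ W^{(1)}(L)` (`(X, Y) ↦ (X/θ², Y/θ³)`, `QuadraticTwistRank.lean`;
`W^{(1)}` is the completed-square model of `W`):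

* the sign `genusSign θ σ ∈ ℤˣ` (`σ θ = genusSign θ σ • θ`) is the tree's (`RingClassGenusCharacter.lean`, with
  `algEquiv_apply_eq_or_eq_neg_of_sq_eq`, `genusSign_mul`); **`exists_signChar_of_sq_eq`** packages it as a CHARACTER
  `χ_θ : Aut(L/F) →* ℤˣ` with `σ θ = χ_θ(σ) • θ` (existence; no new def);
* `conjMap_twistMap_of_apply_eq` — `σ θ = θ ⟹ σ(τ R) = τ R` (the tree has the companion `conjMap_twistMap`: `σ θ = −θ ⟹
  σ(τ R) = −τ R`);
* **`smul_twistMap_eq_signChar_smul`** — `σ • τ R = χ_θ(σ) • τ R` for EVERY `σ ∈ Aut(L/F)` and every `R ∈ W^{(c)}(F)`, the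
  action being the tree's `instDistribMulActionAlgEquivPoint` (`GaloisAction.lean`): twist points are `χ_θ`-eigenvectors —
  exactly the hypothesis `hg` of `two_smul_mem_span_sup_torsion_iff_point` for `g χ_θ := τ(generator of W^{(c)}(F))`.

Pure algebra of the models; no Heegner point, no `L`-function; nothing here is a statement of the line, and NOTHING HERE PROVES
R″ or any summit — BSD is not advanced by this file alone.

## References

* [SilvermanAEC2009] J. H. Silverman, *The Arithmetic of Elliptic Curves*, X.2 (proof of Prop. 2.4), X.5 Cor. 5.4, Ex. 10.16.
* [TianYuanZhang2017] §1 (genus points / twisted Heegner points as eigencomponents).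
-/

noncomputable section

open scoped Classical

namespace Summit.BirchSwinnertonDyer.BirchSwinnertonDyer.Theorems.GenusKolyvaginAtTwo.FullVertex.GenusDepth

open WeierstrassCurve WeierstrassCurve.QuadraticDescent

universe u

variable {F L : Type u} [Field F] [Field L] [Algebra F L]

/-- `θ` and `−θ` are distinct for `θ ∉ F` when `2 ≠ 0`. [cite: SilvermanAEC2009, X.5 Cor. 5.4] -/
theorem neg_ne_self_of_not_mem_range [NeZero (2 : F)] {θ : L} (hθ : θ ∉ Set.range (algebraMap F L)) : -θ ≠ θ := by
  have hθ0 : θ ≠ 0 := Literature.NumberTheory.QuadraticFields.Quadratic.ne_zero_of_not_mem_range hθ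
  have h2 : (2 : L) ≠ 0 := Literature.NumberTheory.QuadraticFields.Quadratic.two_ne_zero' (F := F)
  intro h
  apply hθ0
  have h' : (2 : L) * θ = 0 := by linear_combination -h
  rcases mul_eq_zero.mp h' with h'' | h''
  · exact absurd h'' h2
  · exact h''

/-- **The sign character of a square root.**  For `θ ∈ L ∖ F` with `θ² = c ∈ F` (`2 ≠ 0`) the tree's sign
`genusSign θ : Aut(L/F) → ℤˣ` IS a character `χ_θ : Aut(L/F) →* ℤˣ` with `σ θ = χ_θ(σ) • θ` for every `σ` (for the genus
field `K_gen = K(√q₁*, …)` these are the characters `χ_d`, `d` a sub-product).  Existence only — no definition is introduced.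
[cite: SilvermanAEC2009, X.5 Cor. 5.4] -/
theorem exists_signChar_of_sq_eq [NeZero (2 : F)] {θ : L} {c : F} (hθ : θ ∉ Set.range (algebraMap F L))
    (hc : θ ^ 2 = algebraMap F L c) :
    ∃ χ : (L ≃ₐ[F] L) →* ℤˣ, (∀ σ : L ≃ₐ[F] L, χ σ = Literature.NumberTheory.EllipticCurves.genusSign θ σ) ∧
      ∀ σ : L ≃ₐ[F] L, σ θ = ((χ σ : ℤˣ) : ℤ) • θ := by
  have hneg : θ ≠ -θ := (neg_ne_self_of_not_mem_range hθ).symm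
  refine ⟨MonoidHom.mk' (Literature.NumberTheory.EllipticCurves.genusSign θ)
    (Literature.NumberTheory.EllipticCurves.genusSign_mul hc hneg), fun σ => rfl, fun σ => ?_⟩
  rw [MonoidHom.mk'_apply, zsmul_eq_mul]
  exact Literature.NumberTheory.EllipticCurves.algEquiv_apply_eq_genusSign_mul hc σ

variable [NeZero (2 : F)] (W : WeierstrassCurve F) {θ : L} {c : F}
  (hθ : θ ∉ Set.range (algebraMap F L)) (hc : θ ^ 2 = algebraMap F L c)

/-- **`σ θ = θ ⟹ σ ∘ τ = τ`**: an automorphism fixing `θ` fixes the image of the twisting map pointwise (its coordinates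
`X/θ²`, `Y/θ³` lie in `F(θ)`). Companion of the tree's `conjMap_twistMap` (`σ θ = −θ ⟹ σ ∘ τ = −τ`).
[cite: SilvermanAEC2009, X.5 Cor. 5.4] -/
theorem conjMap_twistMap_of_apply_eq {σ : L →ₐ[F] L} (hσ : σ θ = θ) (R : (W.quadraticTwist c).toAffine.Point) :
    conjMap (W.quadraticTwist 1) σ (twistMap W hθ hc R) = twistMap W hθ hc R := by
  rcases R with _ | ⟨X, Y, hR⟩
  · rw [← Affine.Point.zero_def, map_zero, map_zero]
  · obtain ⟨h', e⟩ := twistMap_some W hθ hc hR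
    rw [e, Affine.Point.map_some]
    simp only [VariableChange.toX_def, VariableChange.toY_def, twistUntwist, sub_zero, zero_mul, inv_pow,
      Units.val_inv_eq_inv_val, Units.val_mk0, map_mul, map_inv₀, map_pow, hσ, AlgHom.commutes]

/-- **Twist points are `χ_θ`-eigenvectors.**  For every `σ ∈ Aut(L/F)` and every `R ∈ W^{(c)}(F)`:
`σ • τ R = χ_θ(σ) • τ R` in `W^{(1)}(L)`, for ANY sign function `χ` with `σ θ = χ(σ) • θ` (e.g. the sign character of
`exists_signChar_of_sq_eq`); the action is the tree's `instDistribMulActionAlgEquivPoint`.  This is the hypothesis `hg` of the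
(LOW) dictionary on points for `g χ_θ := τ(·)`. [cite: SilvermanAEC2009, X.5 Cor. 5.4] [cite: TianYuanZhang2017, §1] -/
theorem smul_twistMap_eq_signChar_smul (χ : (L ≃ₐ[F] L) → ℤˣ) (hχ : ∀ σ : L ≃ₐ[F] L, σ θ = ((χ σ : ℤˣ) : ℤ) • θ)
    (σ : L ≃ₐ[F] L) (R : (W.quadraticTwist c).toAffine.Point) :
    σ • twistMap W hθ hc R = ((χ σ : ℤˣ) : ℤ) • twistMap W hθ hc R := by
  rw [WeierstrassCurve.smul_def]
  rcases Int.units_eq_one_or (χ σ) with h | h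
  · have hσ : (σ : L →ₐ[F] L) θ = θ := by
      have := hχ σ; rw [h] at this; simpa using this
    rw [h, Units.val_one, one_zsmul]
    exact conjMap_twistMap_of_apply_eq W hθ hc hσ R
  · have hσ : (σ : L →ₐ[F] L) θ = -θ := by
      have := hχ σ; rw [h] at this; simpa using this
    rw [h, Units.val_neg, Units.val_one, neg_one_zsmul]
    exact conjMap_twistMap W hθ hc hσ R

/-- **Twist points are `genusSign`-eigenvectors**: `σ • τ R = genusSign θ σ • τ R` (the tree's sign).
[cite: SilvermanAEC2009, X.5 Cor. 5.4] [cite: TianYuanZhang2017, §1] -/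
theorem smul_twistMap_eq_genusSign_smul (σ : L ≃ₐ[F] L) (R : (W.quadraticTwist c).toAffine.Point) :
    σ • twistMap W hθ hc R =
      ((Literature.NumberTheory.EllipticCurves.genusSign θ σ : ℤˣ) : ℤ) • twistMap W hθ hc R :=
  smul_twistMap_eq_signChar_smul W hθ hc _
    (fun σ => by rw [zsmul_eq_mul]; exact Literature.NumberTheory.EllipticCurves.algEquiv_apply_eq_genusSign_mul hc σ) σ R

/-- The eigenvector property packaged with the sign character: there is `χ : Aut(L/F) →* ℤˣ` with `σ θ = χ σ • θ` AND
`σ • τ R = χ σ • τ R` for all `σ`, `R` — the `hg` input of `…GenusDepthPoints.two_smul_mem_span_sup_torsion_iff_point`.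
[cite: SilvermanAEC2009, X.5 Cor. 5.4] [cite: TianYuanZhang2017, §1] -/
theorem exists_signChar_smul_twistMap :
    ∃ χ : (L ≃ₐ[F] L) →* ℤˣ, (∀ σ : L ≃ₐ[F] L, σ θ = ((χ σ : ℤˣ) : ℤ) • θ) ∧
      ∀ (σ : L ≃ₐ[F] L) (R : (W.quadraticTwist c).toAffine.Point),
        σ • twistMap W hθ hc R = ((χ σ : ℤˣ) : ℤ) • twistMap W hθ hc R := by
  obtain ⟨χ, -, hχ⟩ := exists_signChar_of_sq_eq hθ hc
  exact ⟨χ, hχ, fun σ R => smul_twistMap_eq_signChar_smul W hθ hc χ hχ σ R⟩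

end Summit.BirchSwinnertonDyer.BirchSwinnertonDyer.Theorems.GenusKolyvaginAtTwo.FullVertex.GenusDepth

end
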